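import Summits.NavierStokesRegularity.NavierStokesRegularity.Theorems.PoloidalWindowDoorPoloidalWindowRigidityZShockScalarEternal
import Summits.NavierStokesRegularity.NavierStokesRegularity.Theorems.PoloidalWindowDoorPoloidalWindowRigidityZShockPSystemLiouville
import HarnessLib

/-!
# Crux K2 `PoloidalWindowRigidity` (stmt-NavierStokesRegularity-19708), line `z_shock` — ★ RUNG R2 WITHOUT ANY SIGN HYPOTHESIS
# FOR LOCALISED DISTURBANCES: a two-sided solution of the autonomous p-system that is a constant state outside a bounded
# `x`-interval at ONE height is constant (Klainerman–Majda's compact-support theorem read two-sidedly, no smallness)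

`--supports stmt-NavierStokesRegularity-19708 --as helper` (leafhand-ns-poloidalwindowdoor-3 g3, cell decomp-ns, 2026-08-31).  Class-free,
Mathlib + tree files only.  **No stub and no summit is closed by this file; Navier–Stokes regularity is NOT proved here (rung 0).**

The repair census leaves, in the 1-D shadow R2 of the deciding stub `stub_zShockThickAut`, the SIGN-CHANGING case of `κ'`
(`…PSystemNonuniformConst.pSystem_const_nonuniform`, p823120, needs `κ' ≥ 0` on the range); `…ZShockScalarEternal` (p823407)
removed the sign hypothesis for one-family solutions.  Here it is removed for every LOCALISED disturbance of a constant state: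
`pSystem_const_of_compact_disturbance` — a two-sided `C²` solution of `p_z = −κ(w)² w_x`, `w_z = −p_x` on `ℝ × ℝ` with
`0 < κlo ≤ κ(w) ≤ κhi`, `|κ'(w)| ≤ k₁`, `|w_x| ≤ W₁` along the solution, `κ > 0`, `κ ∈ C¹` NOWHERE LINEARLY DEGENERATE and NO sign
condition on `κ'`, which equals the constant state `(wbar, pbar)` for `|x| ≥ R` at the height `z = 0`, is constant.

Proof.  Riemann invariants `r, s = p ± K(w)` (`K' = κ`).  (1) Domain of dependence: a backward characteristic through `(z, x)` meets
the height `0` at `Y(0) ≥ x + κlo z` (`z ≥ 0`) resp. `≤ x + κlo z` (`z ≤ 0`), so `s = sbar` on `{z ≥ 0, x + κlo z ≥ R}` and on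
`{z ≤ 0, x + κlo z ≤ −R}`, with `s_x = 0` in the interior.  (2) A forward characteristic `X` from `(0, x₀)` runs inside those
regions for `|z| ≥ T(x₀)`; there `s = sbar`, `s_x = 0`, and `w ∘ X ≡ v` is the SAME constant at both ends.  (3) Lax's identity
along `X` for `α = r_x` is linear, `α' = −κ'(w) w_x α` (so `α` never vanishes if `α(0) ≠ 0`, `ne_zero_of_linear`), and in the two
regions it is the Riccati equation `α' = −β α²` with the CONSTANT `β = κ'(v)/(2κ(v))`; a never-vanishing solution on a right AND
a left half-line forces `β = 0` (`riccati_const_no_twoSided`: `1/α` is affine with slope `β` on each and would vanish on one).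
(4) If `r_x(0, ·) ≢ 0`, the values `r(0, x)` on an interval where `r_x ≠ 0` fill an interval, so the degenerate values `v` fill an
interval — contradicting nowhere linear degeneracy.  So `r ≡ rbar` (transport) and `…ZShockScalarEternal.pSystem_const_of_forward_flat`
finishes.  Residual of the census after this file: sign-changing `κ'` with PERSISTENT two-family interaction (data not settling to
a constant state at spatial infinity on any slice; Klainerman–Majda's periodic theorem is the forward-in-time model). [folklore]
(Lax 1964; John 1974; Klainerman–Majda 1980)
-/

noncomputable section

namespace Summit.NavierStokesRegularity.NavierStokesRegularity.Theorems.PoloidalWindowDoorPoloidalWindowRigidityZShockCompactDisturbance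

-- the summit and its single sub-problem share the name (CONVENTIONS §1)
set_option linter.dupNamespace false

open Set Filter Topology Function Metric
open scoped NNReal
open Summit.NavierStokesRegularity.NavierStokesRegularity.Theorems.PoloidalWindowDoorPoloidalWindowRigidityZShockPSystemLiouville
open Summit.NavierStokesRegularity.NavierStokesRegularity.Theorems.PoloidalWindowDoorPoloidalWindowRigidityZShockPSystemNonuniform
open Summit.NavierStokesRegularity.NavierStokesRegularity.Theorems.PoloidalWindowDoorPoloidalWindowRigidityZShockScalarEternal

/-! ## One-variable tools: linear non-vanishing, sign persistence, constant-coefficient Riccati on two half-lines -/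

/-- A solution of a LINEAR equation `α' = g α` with bounded coefficient that is nonzero somewhere is nonzero everywhere
(uniqueness: the zero function is the solution through any zero). [folklore] -/
theorem ne_zero_of_linear {α g : ℝ → ℝ} {G z₀ : ℝ} (hα : ∀ z, HasDerivAt α (g z * α z) z) (hG : ∀ z, |g z| ≤ G)
    (h0 : α z₀ ≠ 0) : ∀ z, α z ≠ 0 := by
  intro z₁ hz₁
  have hG0 : 0 ≤ G := (abs_nonneg _).trans (hG z₀)
  have hv : ∀ t, LipschitzOnWith G.toNNReal (fun y : ℝ => g t * y) univ := by
    intro t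
    refine lipschitzOnWith_univ.2 (LipschitzWith.of_dist_le_mul fun x y => ?_)
    rw [Real.dist_eq, Real.dist_eq, ← mul_sub, abs_mul, Real.coe_toNNReal _ hG0]
    exact mul_le_mul_of_nonneg_right (hG t) (abs_nonneg _)
  have heq : α = fun _ => 0 :=
    ODE_solution_unique_univ (v := fun t y => g t * y) (s := fun _ => univ) (t₀ := z₁) hv
      (fun t => ⟨hα t, mem_univ _⟩) (fun t => ⟨by simpa using hasDerivAt_const t (0 : ℝ), mem_univ _⟩)
      (by simpa using hz₁)
  exact h0 (by rw [heq])

/-- A continuous never-vanishing function on `ℝ` has the same sign at any two points. [folklore] -/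
theorem mul_pos_of_ne_zero {α : ℝ → ℝ} (hc : Continuous α) (hne : ∀ z, α z ≠ 0) (a b : ℝ) : 0 < α a * α b := by
  rcases lt_or_gt_of_ne (hne a) with ha | ha <;> rcases lt_or_gt_of_ne (hne b) with hb | hb
  · exact mul_pos_of_neg_of_neg ha hb
  · exfalso
    obtain ⟨c, -, hc0⟩ := intermediate_value_uIcc hc.continuousOn (mem_uIcc.2 (Or.inl ⟨ha.le, hb.le⟩))
    exact hne c hc0
  · exfalso
    obtain ⟨c, -, hc0⟩ := intermediate_value_uIcc hc.continuousOn (mem_uIcc.2 (Or.inr ⟨hb.le, ha.le⟩))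
    exact hne c hc0
  · exact mul_pos ha hb

/-- **Constant-coefficient Riccati: `1/α` is affine.**  If `α' = −β α²` on `[a, b]` and `α` never vanishes, then
`1/α(b) = 1/α(a) + β (b − a)`. [folklore] -/
theorem inv_eq_of_riccati_const {α : ℝ → ℝ} {β a b : ℝ} (hab : a ≤ b)
    (hα : ∀ z ∈ Icc a b, HasDerivAt α (-(β * α z ^ 2)) z) (hne : ∀ z, α z ≠ 0) :
    (α b)⁻¹ = (α a)⁻¹ + β * (b - a) := by
  rcases hab.eq_or_lt with rfl | hlt
  · simp
  set φ : ℝ → ℝ := fun z => (α z)⁻¹ - β * z with hφ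
  have hφd : ∀ z ∈ Icc a b, HasDerivAt φ 0 z := by
    intro z hz
    have hz0 := hne z
    have h1 := (hα z hz).inv hz0
    have h2 : HasDerivAt (fun z => β * z) (β * 1) z := (hasDerivAt_id z).const_mul β
    have h3 : HasDerivAt (fun y => (α y)⁻¹ - β * y) (-(-(β * α z ^ 2)) / α z ^ 2 - β * 1) z := h1.sub h2
    have h4 : -(-(β * α z ^ 2)) / α z ^ 2 - β * 1 = 0 := by
      field_simp
      ring
    exact h3.congr_deriv h4
  have hcont : ContinuousOn φ (Icc a b) := fun z hz => (hφd z hz).continuousAt.continuousWithinAt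
  obtain ⟨c, -, hcd⟩ :=
    exists_hasDerivAt_eq_slope φ (fun _ => 0) hlt hcont (fun z hz => hφd z (Ioo_subset_Icc_self hz))
  have hba : b - a ≠ 0 := sub_ne_zero.2 hlt.ne'
  have h0 : φ b - φ a = 0 := by
    have h := (eq_div_iff hba).1 hcd
    linarith
  simp only [hφ] at h0
  linarith

/-- **Constant-coefficient Riccati on two half-lines.**  If `α` is continuous, never zero on `ℝ`, and solves `α' = −β α²` on
`[T, ∞)` AND on `(−∞, S]` (same `β`), then `β = 0` (`1/α` is affine with slope `β` on each and would vanish on one). [folklore] -/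
theorem riccati_const_no_twoSided {α : ℝ → ℝ} {β T S : ℝ} (hc : Continuous α) (hne : ∀ z, α z ≠ 0)
    (hfwd : ∀ z, T ≤ z → HasDerivAt α (-(β * α z ^ 2)) z)
    (hbwd : ∀ z, z ≤ S → HasDerivAt α (-(β * α z ^ 2)) z) : β = 0 := by
  by_contra hβ
  have hT := hne T
  have hS := hne S
  rcases lt_or_gt_of_ne (mul_ne_zero hβ hT) with hneg | hpos
  · set z₁ : ℝ := T - 1 / (β * α T) with hz₁
    have hTz : T ≤ z₁ := by
      have : 1 / (β * α T) < 0 := one_div_neg.2 hneg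
      rw [hz₁]; linarith
    have h := inv_eq_of_riccati_const hTz (fun z hz => hfwd z hz.1) hne
    have hzero : (α z₁)⁻¹ = 0 := by
      rw [h, hz₁]
      field_simp
      ring
    exact hne z₁ (inv_eq_zero.1 hzero)
  · have hsame : 0 < β * α S := by
      have h1 := mul_pos hpos (mul_pos_of_ne_zero hc hne T S)
      have hT2 : 0 < α T ^ 2 := by positivity
      nlinarith [h1, hT2]
    set z₂ : ℝ := S - 1 / (β * α S) with hz₂
    have hzS : z₂ ≤ S := by
      have : 0 < 1 / (β * α S) := one_div_pos.2 hsame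
      rw [hz₂]; linarith
    have h := inv_eq_of_riccati_const hzS (fun z hz => hbwd z hz.2) hne
    have hzero : (α z₂)⁻¹ = 0 := by
      have : (α z₂)⁻¹ = (α S)⁻¹ - β * (S - z₂) := by linarith
      rw [this, hz₂]
      field_simp
      ring
    exact hne z₂ (inv_eq_zero.1 hzero)

/-! ## The p-system: localised disturbances of a constant state are trivial, with no sign hypothesis on `κ'` -/

variable {w p : ℝ × ℝ → ℝ} {κ κ' K : ℝ → ℝ} {κlo κhi k₁ W₁ R wbar pbar : ℝ}

/-- **★ R2 without sign hypothesis, localised disturbances** (hypotheses and proof: module docstring): a two-sided `C²` solution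
of the autonomous p-system which is a constant state for `|x| ≥ R` at the height `z = 0` is constant on `ℝ × ℝ`. [folklore] -/
theorem pSystem_const_of_compact_disturbance (hw : ContDiff ℝ 2 w) (hp : ContDiff ℝ 2 p)
    (hK2 : ContDiff ℝ 2 K) (hKd : ∀ v, HasDerivAt K (κ v) v) (hκd : ∀ v, HasDerivAt κ (κ' v) v)
    (hsys1 : ∀ q, fderiv ℝ p q (1, 0) = -(κ (w q) ^ 2 * fderiv ℝ w q (0, 1)))
    (hsys2 : ∀ q, fderiv ℝ w q (1, 0) = -fderiv ℝ p q (0, 1))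
    (hκlo0 : 0 < κlo) (hκlo : ∀ q, κlo ≤ κ (w q)) (hκhi : ∀ q, κ (w q) ≤ κhi)
    (hκpos : ∀ v, 0 < κ v) (hgn : ∀ a b : ℝ, a < b → ∃ v ∈ Ioo a b, κ' v ≠ 0)
    (hk₁ : ∀ q, |κ' (w q)| ≤ k₁) (hW₁ : ∀ q, |fderiv ℝ w q (0, 1)| ≤ W₁)
    (hdat : ∀ x : ℝ, R ≤ |x| → w (0, x) = wbar ∧ p (0, x) = pbar) :
    ∀ q q' : ℝ × ℝ, w q = w q' ∧ p q = p q' := by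
  have hw1 : Differentiable ℝ w := hw.differentiable (by simp)
  have hp1 : Differentiable ℝ p := hp.differentiable (by simp)
  have hKmono : StrictMono K := strictMono_of_deriv_pos fun v => by rw [(hKd v).deriv]; exact hκpos v
  have hκB : ∀ q, |κ (w q)| ≤ κhi := fun q => by rw [abs_of_pos (hκpos _)]; exact hκhi q
  -- Riemann invariants
  set r : ℝ × ℝ → ℝ := fun q => p q + K (w q) with hrdef
  set s : ℝ × ℝ → ℝ := fun q => p q - K (w q) with hsdef
  have hr2 : ContDiff ℝ 2 r := hp.add (hK2.comp hw)
  have hr1 : Differentiable ℝ r := hr2.differentiable (by simp)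
  have hKw : ∀ q, HasFDerivAt (fun q' => K (w q')) (κ (w q) • fderiv ℝ w q) q :=
    fun q => (hKd (w q)).comp_hasFDerivAt q (hw1 q).hasFDerivAt
  have hrF : ∀ q, HasFDerivAt r (fderiv ℝ p q + κ (w q) • fderiv ℝ w q) q :=
    fun q => (hp1 q).hasFDerivAt.add (hKw q)
  have hsF : ∀ q, HasFDerivAt s (fderiv ℝ p q - κ (w q) • fderiv ℝ w q) q :=
    fun q => (hp1 q).hasFDerivAt.sub (hKw q)
  have hs1 : Differentiable ℝ s := fun q => (hsF q).differentiableAt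
  have hrD : ∀ q v, fderiv ℝ r q v = fderiv ℝ p q v + κ (w q) * fderiv ℝ w q v := by
    intro q v
    rw [(hrF q).fderiv]
    simp [smul_eq_mul]
  have hsD : ∀ q v, fderiv ℝ s q v = fderiv ℝ p q v - κ (w q) * fderiv ℝ w q v := by
    intro q v
    rw [(hsF q).fderiv]
    simp [smul_eq_mul]
  -- the forward speed field and the two diagonal equations
  set c₁ : ℝ × ℝ → ℝ := fun q => κ (w q) with hc₁
  have hκw : ∀ q, HasFDerivAt (fun q' => κ (w q')) (κ' (w q) • fderiv ℝ w q) q :=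
    fun q => (hκd (w q)).comp_hasFDerivAt q (hw1 q).hasFDerivAt
  have hc₁d : Differentiable ℝ c₁ := fun q => (hκw q).differentiableAt
  have hc₁x : ∀ q, fderiv ℝ c₁ q (0, 1) = κ' (w q) * fderiv ℝ w q (0, 1) := by
    intro q; rw [hc₁, (hκw q).fderiv]; simp [smul_eq_mul]
  have hPDE1 : ∀ q, fderiv ℝ r q (1, 0) + c₁ q * fderiv ℝ r q (0, 1) = 0 := by
    intro q; rw [hrD, hrD, hc₁, hsys1, hsys2]; ring
  have hPDE2 : ∀ q, fderiv ℝ s q (1, 0) + (fun q => -κ (w q)) q * fderiv ℝ s q (0, 1) = 0 := by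
    intro q; simp only; rw [hsD, hsD, hsys1, hsys2]; ring
  -- global characteristics of both families (speed fields bounded and uniformly `x`-Lipschitz)
  have hκd' : ∀ v, HasDerivAt (fun v => -κ v) ((fun v => -κ' v) v) v := fun v => (hκd v).neg
  have hκB' : ∀ q, |(fun v => -κ v) (w q)| ≤ κhi := fun q => by simp only [abs_neg]; exact hκB q
  have hk₁' : ∀ q, |(fun v => -κ' v) (w q)| ≤ k₁ := fun q => by simp only [abs_neg]; exact hk₁ q
  have hfwd : ∀ z₀ x₀ : ℝ, ∃ X : ℝ → ℝ, X z₀ = x₀ ∧ ∀ z, HasDerivAt X (κ (w (z, X z))) z :=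
    fun z₀ x₀ => exists_global_char hw1 hκd hκB hk₁ hW₁ z₀ x₀
  have hbwd : ∀ z₀ x₀ : ℝ, ∃ Y : ℝ → ℝ, Y z₀ = x₀ ∧ ∀ z, HasDerivAt Y (-κ (w (z, Y z))) z :=
    fun z₀ x₀ => exists_global_char (c := fun v => -κ v) hw1 hκd' hκB' hk₁' hW₁ z₀ x₀
  -- the data in Riemann-invariant form
  set sbar : ℝ := pbar - K wbar with hsbar
  set rbar : ℝ := pbar + K wbar with hrbar
  have hsdat : ∀ x : ℝ, R ≤ |x| → s (0, x) = sbar := fun x hx => by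
    simp only [hsdef, hsbar, (hdat x hx).1, (hdat x hx).2]
  have hrdat : ∀ x : ℝ, R ≤ |x| → r (0, x) = rbar := fun x hx => by
    simp only [hrdef, hrbar, (hdat x hx).1, (hdat x hx).2]
  -- (1) DOMAIN OF DEPENDENCE for `s`
  have hsA : ∀ z x : ℝ, (0 ≤ z ∧ R ≤ x + κlo * z) ∨ (z ≤ 0 ∧ x + κlo * z ≤ -R) → s (z, x) = sbar := by
    intro z x hzx
    obtain ⟨Y, hY0, hY⟩ := hbwd z x
    have hYd : Differentiable ℝ Y := fun t => (hY t).differentiableAt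
    have hYle : ∀ t, deriv Y t ≤ -κlo := fun t => by rw [(hY t).deriv]; linarith [hκlo (t, Y t)]
    have hconst : s (z, x) = s (0, Y 0) := by
      have h := const_along (c := fun q => -κ (w q)) hs1 hPDE2 hY z 0
      rwa [hY0] at h
    rw [hconst]
    apply hsdat
    rcases hzx with ⟨hz, hR⟩ | ⟨hz, hR⟩
    · have h := image_sub_le_mul_sub_of_deriv_le hYd hYle hz
      rw [hY0] at h
      have : R ≤ Y 0 := by nlinarith
      exact this.trans (le_abs_self _)
    · have h := image_sub_le_mul_sub_of_deriv_le hYd hYle hz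
      rw [hY0] at h
      have : Y 0 ≤ -R := by nlinarith
      have : R ≤ -Y 0 := by linarith
      exact this.trans (neg_le_abs _)
  -- `s_x = 0` in the interior of the two regions
  have hsB : ∀ z x : ℝ, (0 ≤ z ∧ R < x + κlo * z) ∨ (z ≤ 0 ∧ x + κlo * z < -R) → fderiv ℝ s (z, x) (0, 1) = 0 := by
    intro z x hzx
    have hγ : HasDerivAt (fun y : ℝ => ((z, y) : ℝ × ℝ)) ((0 : ℝ), (1 : ℝ)) x :=
      (hasDerivAt_const x z).prodMk (hasDerivAt_id x)
    have hσ : HasDerivAt (fun y : ℝ => s (z, y)) (fderiv ℝ s (z, x) ((0 : ℝ), (1 : ℝ))) x :=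
      (hs1 (z, x)).hasFDerivAt.comp_hasDerivAt x hγ
    have hev : (fun y : ℝ => s (z, y)) =ᶠ[𝓝 x] fun _ => sbar := by
      rcases hzx with ⟨hz, hR⟩ | ⟨hz, hR⟩
      · have hε : 0 < x + κlo * z - R := by linarith
        filter_upwards [Ioo_mem_nhds (show x - (x + κlo * z - R) < x by linarith)
          (show x < x + (x + κlo * z - R) by linarith)] with y hy
        exact hsA z y (Or.inl ⟨hz, by linarith [hy.1]⟩)
      · have hε : 0 < -R - (x + κlo * z) := by linarith
        filter_upwards [Ioo_mem_nhds (show x - (-R - (x + κlo * z)) < x by linarith)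
          (show x < x + (-R - (x + κlo * z)) by linarith)] with y hy
        exact hsA z y (Or.inr ⟨hz, by linarith [hy.2]⟩)
    have h0 : HasDerivAt (fun y : ℝ => s (z, y)) 0 x := (hasDerivAt_const x sbar).congr_of_eventuallyEq hev
    exact hσ.unique h0
  -- (2)+(3) along a forward characteristic from `(0, x₀)` with `r_x(0, x₀) ≠ 0`, the limiting value `v` is degenerate
  have hC : ∀ x₀ : ℝ, fderiv ℝ r (0, x₀) (0, 1) ≠ 0 → ∃ v : ℝ, K v = (r (0, x₀) - sbar) / 2 ∧ κ' v = 0 := by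
    intro x₀ hα0
    obtain ⟨X, hX0, hX⟩ := hfwd 0 x₀
    have hXd : Differentiable ℝ X := fun t => (hX t).differentiableAt
    have hXge : ∀ t, κlo ≤ deriv X t := fun t => by rw [(hX t).deriv]; exact hκlo (t, X t)
    have hrX : ∀ z, r (z, X z) = r (0, x₀) := fun z => by
      have h := const_along (c := c₁) hr1 hPDE1 hX z 0
      rwa [hX0] at h
    -- position of `X` relative to the regions
    have hXfwd : ∀ z, 0 ≤ z → x₀ + κlo * z ≤ X z := fun z hz => by
      have h := mul_sub_le_image_sub_of_le_deriv hXd hXge hz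
      rw [hX0] at h; linarith
    have hXbwd : ∀ z, z ≤ 0 → X z ≤ x₀ + κlo * z := fun z hz => by
      have h := mul_sub_le_image_sub_of_le_deriv hXd hXge hz
      rw [hX0] at h; linarith
    set T : ℝ := (|R| + |x₀| + 1) / (2 * κlo) with hT
    have hT0 : 0 < T := by rw [hT]; positivity
    have h2T : 2 * κlo * T = |R| + |x₀| + 1 := by rw [hT]; field_simp
    have hgood : ∀ z, (T ≤ z ∨ z ≤ -T) →
        (0 ≤ z ∧ R < X z + κlo * z) ∨ (z ≤ 0 ∧ X z + κlo * z < -R) := by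
      intro z hz
      rcases hz with hz | hz
      · refine Or.inl ⟨hT0.le.trans hz, ?_⟩
        have h1 := hXfwd z (hT0.le.trans hz)
        have h3 : 2 * κlo * T ≤ 2 * κlo * z := by nlinarith
        linarith [le_abs_self R, neg_abs_le x₀, h2T]
      · refine Or.inr ⟨by linarith, ?_⟩
        have h1 := hXbwd z (by linarith)
        have h3 : 2 * κlo * z ≤ -(2 * κlo * T) := by nlinarith
        linarith [le_abs_self R, le_abs_self x₀, h2T]
    have hsX : ∀ z, (T ≤ z ∨ z ≤ -T) → s (z, X z) = sbar := fun z hz => by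
      rcases hgood z hz with ⟨h1, h2⟩ | ⟨h1, h2⟩
      · exact hsA z (X z) (Or.inl ⟨h1, h2.le⟩)
      · exact hsA z (X z) (Or.inr ⟨h1, h2.le⟩)
    have hsxX : ∀ z, (T ≤ z ∨ z ≤ -T) → fderiv ℝ s (z, X z) (0, 1) = 0 := fun z hz => hsB z (X z) (hgood z hz)
    -- `w ∘ X` is the same constant `v` at both ends
    set v : ℝ := w (T, X T) with hv
    have hKv : K v = (r (0, x₀) - sbar) / 2 := by
      have h1 := hrX T
      have h2 := hsX T (Or.inl le_rfl)
      simp only [hrdef, hsdef] at h1 h2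
      rw [hv]; linarith
    have hwX : ∀ z, (T ≤ z ∨ z ≤ -T) → w (z, X z) = v := by
      intro z hz
      apply hKmono.injective
      have h1 := hrX z
      have h2 := hsX z hz
      simp only [hrdef, hsdef] at h1 h2
      rw [hKv]; linarith
    -- Lax's identity along `X`: `α' = −κ'(w) w_x α`
    set α : ℝ → ℝ := fun t => fderiv ℝ r (t, X t) (0, 1) with hαdef
    have hLax : ∀ z, HasDerivAt α (-(κ' (w (z, X z)) * fderiv ℝ w (z, X z) (0, 1)) * α z) z := by
      intro z
      have h := transversal_deriv_along_of_speed hr2 hc₁d hPDE1 hX z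
      rw [hc₁x] at h
      refine h.congr_deriv ?_
      simp only [hαdef]; ring
    have hαc : Continuous α := continuous_iff_continuousAt.2 fun z => (hLax z).continuousAt
    have hαne : ∀ z, α z ≠ 0 := by
      refine ne_zero_of_linear (G := k₁ * W₁) (z₀ := 0) hLax (fun z => ?_) (by simpa [hαdef, hX0] using hα0)
      rw [abs_neg, abs_mul]
      exact mul_le_mul (hk₁ _) (hW₁ _) (abs_nonneg _) ((abs_nonneg _).trans (hk₁ (z, X z)))
    -- in the two regions the equation is the constant-coefficient Riccati equation
    set β : ℝ := κ' v / (2 * κ v) with hβ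
    have hκv : κ v ≠ 0 := (hκpos v).ne'
    have hRic : ∀ z, (T ≤ z ∨ z ≤ -T) → HasDerivAt α (-(β * α z ^ 2)) z := by
      intro z hz
      have hwx : fderiv ℝ w (z, X z) (0, 1) = α z / (2 * κ v) := by
        have h1 := hrD (z, X z) (0, 1)
        have h2 := hsD (z, X z) (0, 1)
        rw [hsxX z hz] at h2
        rw [hwX z hz] at h1 h2
        simp only [hαdef]
        field_simp
        linarith
      refine (hLax z).congr_deriv ?_
      rw [hwX z hz, hwx, hβ]
      field_simp
    have hβ0 : β = 0 :=
      riccati_const_no_twoSided (T := T) (S := -T) hαc hαne (fun z hz => hRic z (Or.inl hz))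
        (fun z hz => hRic z (Or.inr hz))
    refine ⟨v, hKv, ?_⟩
    have : κ' v / (2 * κ v) = 0 := by rw [← hβ]; exact hβ0
    rcases div_eq_zero_iff.1 this with h | h
    · exact h
    · exact absurd h (mul_ne_zero two_ne_zero hκv)
  -- (4) `r_x(0, ·) ≡ 0`
  have hρd : ∀ x, HasDerivAt (fun y : ℝ => r (0, y)) (fderiv ℝ r (0, x) ((0 : ℝ), (1 : ℝ))) x := fun x =>
    (hr1 (0, x)).hasFDerivAt.comp_hasDerivAt x ((hasDerivAt_const x (0 : ℝ)).prodMk (hasDerivAt_id x))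
  have hρc : Continuous fun y : ℝ => r (0, y) := hr1.continuous.comp (continuous_const.prodMk continuous_id)
  have hρ'c : Continuous fun x : ℝ => fderiv ℝ r (0, x) (0, 1) :=
    ((hr2.continuous_fderiv (by simp)).comp (continuous_const.prodMk continuous_id)).clm_apply continuous_const
  have hD : ∀ x, fderiv ℝ r (0, x) (0, 1) = 0 := by
    intro x₁
    by_contra hne
    -- `r_x(0, ·) ≠ 0` on a ball around `x₁`
    obtain ⟨δ, hδ, hball⟩ : ∃ δ > 0, ∀ x, dist x x₁ < δ → fderiv ℝ r (0, x) (0, 1) ≠ 0 := by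
      have hev := (hρ'c.continuousAt (x := x₁)).eventually_ne hne
      obtain ⟨δ, hδ, h⟩ := Metric.eventually_nhds_iff.1 hev
      exact ⟨δ, hδ, fun x hx => h hx⟩
    -- two points with different values of `r(0, ·)`
    have hlt : x₁ < x₁ + δ / 2 := by linarith
    obtain ⟨η, hη, hηd⟩ := exists_hasDerivAt_eq_slope (fun y : ℝ => r (0, y)) (fun x => fderiv ℝ r (0, x) (0, 1))
      hlt hρc.continuousOn (fun x _ => hρd x)
    have hIcc_ball : ∀ x ∈ Icc x₁ (x₁ + δ / 2), dist x x₁ < δ := fun x hx => by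
      rw [Real.dist_eq, abs_lt]; constructor <;> linarith [hx.1, hx.2]
    have hneq : r (0, x₁) ≠ r (0, x₁ + δ / 2) := by
      intro heq
      have : fderiv ℝ r (0, η) (0, 1) = 0 := by rw [hηd, heq, sub_self, zero_div]
      exact hball η (hIcc_ball η (Ioo_subset_Icc_self hη)) this
    -- order them: `xa, xb ∈ [x₁, x₁ + δ/2]` with `r(0, xa) < r(0, xb)`
    obtain ⟨xa, xb, hxa, hxb, hab⟩ : ∃ xa xb : ℝ, xa ∈ Icc x₁ (x₁ + δ / 2) ∧ xb ∈ Icc x₁ (x₁ + δ / 2) ∧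
        r (0, xa) < r (0, xb) := by
      rcases lt_or_gt_of_ne hneq with h | h
      · exact ⟨x₁, x₁ + δ / 2, left_mem_Icc.2 hlt.le, right_mem_Icc.2 hlt.le, h⟩
      · exact ⟨x₁ + δ / 2, x₁, right_mem_Icc.2 hlt.le, left_mem_Icc.2 hlt.le, h⟩
    obtain ⟨va, hKva, -⟩ := hC xa (hball xa (hIcc_ball xa hxa))
    obtain ⟨vb, hKvb, -⟩ := hC xb (hball xb (hIcc_ball xb hxb))
    have hvab : va < vb := hKmono.lt_iff_lt.1 (by rw [hKva, hKvb]; linarith)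
    obtain ⟨v, hv, hv'⟩ := hgn va vb hvab
    -- the value `2 K(v) + sbar` lies strictly between `r(0, xa)` and `r(0, xb)`, so it is attained in between
    have hKv1 : K va < K v := hKmono hv.1
    have hKv2 : K v < K vb := hKmono hv.2
    have hmem : 2 * K v + sbar ∈ uIcc (r (0, xa)) (r (0, xb)) := by
      rw [uIcc_of_le hab.le]
      constructor <;> linarith
    have hsubI : uIcc xa xb ⊆ Icc x₁ (x₁ + δ / 2) := uIcc_subset_Icc hxa hxb
    obtain ⟨x, hx, hxv⟩ := intermediate_value_uIcc (hρc.continuousOn) hmem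
    obtain ⟨v', hKv', hκv'⟩ := hC x (hball x (hIcc_ball x (hsubI hx)))
    have hvv : v' = v := hKmono.injective (by rw [hKv']; simp only at hxv; linarith)
    exact hv' (hvv ▸ hκv')
  -- (5) `r ≡ rbar` on `ℝ × ℝ`, so the solution is forward-flat
  have hρconst : ∀ x, r (0, x) = rbar := by
    intro x
    have h := is_const_of_deriv_eq_zero (f := fun y : ℝ => r (0, y)) (fun y => (hρd y).differentiableAt)
      (fun y => by rw [(hρd y).deriv, hD y]) x |R|
    rw [h]
    exact hrdat |R| (by rw [abs_abs]; exact le_abs_self R)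
  have hrconst : ∀ q : ℝ × ℝ, r q = rbar := by
    rintro ⟨z, x⟩
    obtain ⟨X, hX0, hX⟩ := hfwd z x
    have h := const_along (c := c₁) hr1 hPDE1 hX z 0
    rw [hX0] at h
    rw [h, hρconst]
  have hflat : ∀ q, fderiv ℝ p q (0, 1) + κ (w q) * fderiv ℝ w q (0, 1) = 0 := by
    intro q
    rw [← hrD, show r = fun _ => rbar from funext hrconst]
    simp
  exact pSystem_const_of_forward_flat hw1 hp1 hκd hsys1 hsys2 hκpos hκhi hk₁ hW₁ hgn hflat

end Summit.NavierStokesRegularity.NavierStokesRegularity.Theorems.PoloidalWindowDoorPoloidalWindowRigidityZShockCompactDisturbance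

end
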